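/-
Copyright (c) 2026 the pub-hodgecm-mathlib formalisation cell (harness21).  Prover seat hodgecm-mathlib-K2E3-p24 (g2), HCML Track B «K2-LIT» ∕ h413 (`stmt-HodgeConjecture-24833`),
line «SC′-IRR-lev» (leaf (S-C′-irr) `sig_K2E3GL3TwoBlockInducedIrreducible`; lead K2E3-p24, dealer D82), brick JM-A part 3 (`r_B(i_Q σ') = 0`).  2026-09-04.
-/
import Summits.HodgeConjecture.HodgeConjecture.Theorems.K2E3GL3CuspidalBlockJacquetSame   -- JM-A part 2 (this seat): `f(1) = 0 ⇒ [f]_Q = 0`, `exists_toFun_one_eq`; brings K0, part 1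
import HarnessLib

/-!
# K2_E3 road (h413), line «SC′-IRR-lev», brick JM-A part 3 — the BOREL Jacquet module of `Ind_{P₍₂,₁₎}^{GL₃} σ'` vanishes when `W = W(X₁₀) = W(X₀₁)`

Cell `pub/hodgecm-mathlib` (D-0151), Track B, seat K2E3-p24 (g2) = LEAD of line «SC′-IRR-lev».  `--supports stmt-HodgeConjecture-24833 --as helper`; THEOREMS ONLY
(no definition ∕ instance ∕ notation ∕ named fact ∕ `sorry`); never imports `Cruxes/…/Lines`.  COUNT-NEUTRAL.

THE MATHEMATICS ([BernsteinZelevinsky1977, §1.8–1.9, 2.12]; [Casselman1995, §6.3]).  `P = P₍₂,₁₎ ≤ GL₃(F)`, `U_Q` its radical, `B = P_{id}` the Borel with radical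
`U₃ = upperUnitriangular ⊇ U_Q`, `σ'` a smooth representation of `P` on `W`, `I = Ind_P^{GL₃} σ'`.  By transitivity of Jacquet functors `r_B(I) = r_{B ∩ M}(r_Q(I))`, and
JM-A part 2 gives `r_Q(I) ≅ W` via `f ↦ f(1)` (`I(U_Q) = {f : f(1) = 0}` when `W = W(X₁₀)`); the radical of `B ∩ M` is the UPPER root group `X₀₁` of the `GL₂` block, so if also
`W = W(X₀₁)` then `r_B(I) = W ∕ W(X₀₁) = 0`.  Element-wise, with no transitivity theorem: `I(U_Q) ≤ I(U₃)` (`ker_restrictUnipotentGL_twoOne_le_id`), and for `f ∈ I` with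
`f(1) = Σ_j (σ'(x₀₁ a_j) w_j - w_j)` pick sections `g_j` with `g_j(1) = w_j` (★ part 2 `exists_toFun_one_eq`); then `x₀₁(a_j)·g_j - g_j ∈ I(U₃)` has value
`σ'(x₀₁ a_j) w_j - w_j` at `1`, so `f - Σ_j (x₀₁(a_j)·g_j - g_j)` vanishes at `1`, lies in `I(U_Q) ≤ I(U₃)` (★ part 2 `mk_eq_zero_of_toFun_one_eq_zero`), and `f ∈ I(U₃)`:
**`ker_restrictUnipotentGL_id_eq_top`**, **`subsingleton_coinvariants_restrictUnipotentGL_id`** (`r_B(I) = 0`).  For `σ' = (σ ∘ proj) ⊗ δ^{1∕2}` with `σ` irreducible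
supercuspidal both span hypotheses are ★ BLK (K2E3-p21, `mem_span_twist_transvection_{one_zero,zero_one}_sub`): `ρ × χ` has no Borel Jacquet module.

HONEST LABEL: HC_CM is proved only modulo the 7 printed citations (2 remaining named inputs: hLiu418 = stmt-HodgeConjecture-24832, h413 = stmt-HodgeConjecture-24833)
until rung 0 closes; count-neutral helper.

## Mathlib ∕ tree search
Tree (★, by name): `mem_unipotentRadicalGL_iff_apply`, `upperUnitriangular` (`= unipotentRadicalGL R id`), `transvectionUnit_mem_upperUnitriangular`, JM-A part 2
`mk_eq_zero_of_toFun_one_eq_zero`, `exists_toFun_one_eq`, K0 `monotone_twoOne`, `transvectionUnit_zero_one_mem_standardParabolicGL`.  Mathlib: `Representation.Coinvariants.{ker,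
mk_eq_zero, sub_mem_ker}`, `Submodule.span_induction`, `Subgroup.mem_map`.  Dedup: `rg "CuspidalBlockJacquetBorel|ker_restrictUnipotentGL_id_eq_top"` — none.

## References
* [BernsteinZelevinsky1977] I. N. Bernstein, A. V. Zelevinsky, *Induced representations of reductive 𝔭-adic groups I*, Ann. Sci. ÉNS 10 (1977), §1.8–1.9, 2.12, Thm. 5.2.
* [Casselman1995] W. Casselman, *Introduction to the theory of admissible representations of 𝔭-adic reductive groups* (1995), §6.3.
-/

set_option autoImplicit false
set_option linter.dupNamespace false

noncomputable section

open Matrix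

namespace Summit.HodgeConjecture.HodgeConjecture.Cruxes.H413.K2E3GL3CuspidalBlockJacquetBorel

open Literature.NumberTheory.Automorphic K2E3GL3MaximalParabolicRelabel K2E3GL3CuspidalBlockJacquetSame

variable {F : Type*} [Field F] [ValuativeRel F] [TopologicalSpace F] [IsNonarchimedeanLocalField F]

/-! ## §1  `U_Q ≤ U₃` and `I(U_Q) ≤ I(U₃)` -/

section Inclusion

omit [ValuativeRel F] [TopologicalSpace F] [IsNonarchimedeanLocalField F] in
/-- `U_Q ≤ U₃`: the unipotent radical of `P₍₂,₁₎` consists of upper unitriangular matrices (the labelling `![0,0,1]` is monotone). [cite: BernsteinZelevinsky1977, §2.1] -/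
theorem unipotentRadicalGL_twoOne_le_upperUnitriangular :
    unipotentRadicalGL F (![0, 0, 1] : Fin 3 → Fin 2) ≤ upperUnitriangular (Fin 3) F := by
  intro g hg
  rw [mem_unipotentRadicalGL_iff_apply] at hg
  rw [upperUnitriangular, mem_unipotentRadicalGL_iff_apply]
  exact fun i j hij => hg i j (monotone_twoOne hij)

omit [ValuativeRel F] [TopologicalSpace F] [IsNonarchimedeanLocalField F] in
/-- **`I(U_Q) ≤ I(U₃)` for any representation `π` of `GL₃(F)`**: the `U_Q`-coinvariant kernel lies in the `U₃`-coinvariant kernel (each generator `π(u) v - v`,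
`u ∈ U_Q ≤ U₃`, is a generator of the latter). [cite: BernsteinZelevinsky1977, §1.8] -/
theorem ker_restrictUnipotentGL_twoOne_le_id {V : Type*} [AddCommGroup V] [Module ℂ V] (π : Representation ℂ (GL (Fin 3) F) V) :
    Representation.Coinvariants.ker (Representation.restrictUnipotentGL F (![0, 0, 1] : Fin 3 → Fin 2) π) ≤
      Representation.Coinvariants.ker (Representation.restrictUnipotentGL F (id : Fin 3 → Fin 3) π) := by
  rw [Representation.Coinvariants.ker, Submodule.span_le]
  rintro _ ⟨⟨u, v⟩, rfl⟩
  have hu : ((u : ↥(standardParabolicGL F (![0, 0, 1] : Fin 3 → Fin 2))) : GL (Fin 3) F) ∈ unipotentRadicalGL F (id : Fin 3 → Fin 3) :=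
    unipotentRadicalGL_twoOne_le_upperUnitriangular (Subgroup.mem_map.2 ⟨u, u.2, rfl⟩)
  obtain ⟨u', hu', hu'eq⟩ := Subgroup.mem_map.1 hu
  have key : Representation.restrictUnipotentGL F (![0, 0, 1] : Fin 3 → Fin 2) π u v - v =
      Representation.restrictUnipotentGL F (id : Fin 3 → Fin 3) π ⟨u', hu'⟩ v - v := by
    change π ((u : ↥(standardParabolicGL F (![0, 0, 1] : Fin 3 → Fin 2))) : GL (Fin 3) F) v - v =
      π ((u' : ↥(standardParabolicGL F (id : Fin 3 → Fin 3))) : GL (Fin 3) F) v - v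
    rw [← hu'eq]
    rfl
  change Representation.restrictUnipotentGL F (![0, 0, 1] : Fin 3 → Fin 2) π u v - v ∈
    (Representation.Coinvariants.ker (Representation.restrictUnipotentGL F (id : Fin 3 → Fin 3) π) : Set V)
  rw [SetLike.mem_coe, key]
  exact Representation.Coinvariants.sub_mem_ker _ _

omit [ValuativeRel F] [TopologicalSpace F] [IsNonarchimedeanLocalField F] in
/-- `π(x₀₁(a)) g - g ∈ I(U₃)` (`x₀₁(a) ∈ U₃`). [cite: BernsteinZelevinsky1977, §1.8] -/
theorem apply_transvectionUnit_zero_one_sub_mem_ker {V : Type*} [AddCommGroup V] [Module ℂ V] (π : Representation ℂ (GL (Fin 3) F) V) (a : F) (g : V) :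
    π (transvectionUnit 0 1 (by decide) a) g - g ∈ Representation.Coinvariants.ker (Representation.restrictUnipotentGL F (id : Fin 3 → Fin 3) π) := by
  have hu : (transvectionUnit 0 1 (by decide) a : GL (Fin 3) F) ∈ unipotentRadicalGL F (id : Fin 3 → Fin 3) :=
    transvectionUnit_mem_upperUnitriangular (show (0 : Fin 3) < 1 by decide) a
  obtain ⟨u', hu', hu'eq⟩ := Subgroup.mem_map.1 hu
  have key : π (transvectionUnit 0 1 (by decide) a) g - g = Representation.restrictUnipotentGL F (id : Fin 3 → Fin 3) π ⟨u', hu'⟩ g - g := by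
    change _ = π ((u' : ↥(standardParabolicGL F (id : Fin 3 → Fin 3))) : GL (Fin 3) F) g - g
    rw [← hu'eq]
    rfl
  rw [key]
  exact Representation.Coinvariants.sub_mem_ker _ _

end Inclusion

/-! ## §2  `r_B(Ind_P σ') = 0` -/

section Borel

variable {W : Type*} [AddCommGroup W] [Module ℂ W] (σ' : Representation ℂ ↥(standardParabolicGL F (![0, 0, 1] : Fin 3 → Fin 2)) W)

/-- **`I(U₃) = I` FOR `I = Ind_{P₍₂,₁₎}^{GL₃} σ'`** when `σ'` is smooth with `W = W(X₁₀)` (hW, JM-A) and `W = W(X₀₁)` (hW₀₁): every `f ∈ I` lies in the `U₃`-coinvariant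
kernel.  Induction along the span hW₀₁ of the value `f(1)`: for `f(1) = σ'(x₀₁ a) v - v` and a section `g` with `g(1) = v`, `h = x₀₁(a)·g - g ∈ I(U₃)` has `h(1) = f(1)`,
so `f - h ∈ I(U_Q) ≤ I(U₃)`. [cite: BernsteinZelevinsky1977, 2.12] [cite: Casselman1995, §6.3] -/
theorem ker_restrictUnipotentGL_id_eq_top (hσ' : σ'.IsSmooth)
    (hW : ∀ w : W, w ∈ Submodule.span ℂ {x : W | ∃ (y : F) (v : W),
      x = σ' ⟨transvectionUnit 1 0 (by decide) y, transvectionUnit_one_zero_mem_standardParabolicGL y⟩ v - v})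
    (hW₀₁ : ∀ w : W, w ∈ Submodule.span ℂ {x : W | ∃ (a : F) (v : W),
      x = σ' ⟨transvectionUnit 0 1 (by decide) a, transvectionUnit_zero_one_mem_standardParabolicGL a⟩ v - v}) :
    Representation.Coinvariants.ker (Representation.restrictUnipotentGL F (id : Fin 3 → Fin 3)
      (Representation.smoothIndRep (standardParabolicGL F (![0, 0, 1] : Fin 3 → Fin 2)) σ')) = ⊤ := by
  -- evaluation at `1` as a linear map
  let ev : Representation.SmoothInd (standardParabolicGL F (![0, 0, 1] : Fin 3 → Fin 2)) σ' →ₗ[ℂ] W :=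
    { toFun := fun g => g.toFun 1
      map_add' := fun g g' => by rw [Representation.SmoothInd.toFun_add]; rfl
      map_smul' := fun a g => by rw [Representation.SmoothInd.toFun_smul]; rfl }
  have hev : ∀ g, ev g = g.toFun 1 := fun _ => rfl
  -- `I(U_Q) ≤ I(U₃)` and `f(1) = 0 ⇒ f ∈ I(U₃)`
  have hQ : ∀ f : Representation.SmoothInd (standardParabolicGL F (![0, 0, 1] : Fin 3 → Fin 2)) σ', ev f = 0 →
      f ∈ Representation.Coinvariants.ker (Representation.restrictUnipotentGL F (id : Fin 3 → Fin 3)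
        (Representation.smoothIndRep (standardParabolicGL F (![0, 0, 1] : Fin 3 → Fin 2)) σ')) := fun f hf =>
    ker_restrictUnipotentGL_twoOne_le_id _ ((Representation.Coinvariants.mk_eq_zero _).1 (mk_eq_zero_of_toFun_one_eq_zero σ' hσ' hW f hf))
  -- the claim, by induction on `f(1)` along the span hW₀₁
  suffices key : ∀ w : W, w ∈ Submodule.span ℂ {x : W | ∃ (a : F) (v : W),
      x = σ' ⟨transvectionUnit 0 1 (by decide) a, transvectionUnit_zero_one_mem_standardParabolicGL a⟩ v - v} →
      ∀ f : Representation.SmoothInd (standardParabolicGL F (![0, 0, 1] : Fin 3 → Fin 2)) σ', ev f = w →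
        f ∈ Representation.Coinvariants.ker (Representation.restrictUnipotentGL F (id : Fin 3 → Fin 3)
          (Representation.smoothIndRep (standardParabolicGL F (![0, 0, 1] : Fin 3 → Fin 2)) σ')) by
    exact eq_top_iff.2 fun f _ => key (ev f) (hW₀₁ _) f rfl
  intro w hw
  induction hw using Submodule.span_induction with
  | mem x hx =>
    obtain ⟨a, v, rfl⟩ := hx
    intro f hf
    obtain ⟨g, hg⟩ := exists_toFun_one_eq σ' hσ' v
    set h := Representation.smoothIndRep (standardParabolicGL F (![0, 0, 1] : Fin 3 → Fin 2)) σ' (transvectionUnit 0 1 (by decide) a) g - g with hh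
    have hhker := apply_transvectionUnit_zero_one_sub_mem_ker (Representation.smoothIndRep (standardParabolicGL F (![0, 0, 1] : Fin 3 → Fin 2)) σ') a g
    have hmul : g.toFun (transvectionUnit 0 1 (by decide) a) =
        σ' ⟨transvectionUnit 0 1 (by decide) a, transvectionUnit_zero_one_mem_standardParabolicGL a⟩ (g.toFun 1) := by
      simpa only [mul_one] using Representation.SmoothInd.toFun_subgroup_mul g
        ⟨transvectionUnit 0 1 (by decide) a, transvectionUnit_zero_one_mem_standardParabolicGL a⟩ 1
    have hh1 : ev h = σ' ⟨transvectionUnit 0 1 (by decide) a, transvectionUnit_zero_one_mem_standardParabolicGL a⟩ v - v := by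
      rw [hh, map_sub, hev, hev, Representation.toFun_smoothIndRep_apply, one_mul, hmul, hg]
    have hfh : f - h ∈ Representation.Coinvariants.ker (Representation.restrictUnipotentGL F (id : Fin 3 → Fin 3)
        (Representation.smoothIndRep (standardParabolicGL F (![0, 0, 1] : Fin 3 → Fin 2)) σ')) :=
      hQ _ (by rw [map_sub, hf, hh1, sub_self])
    have : f = (f - h) + h := by abel
    rw [this]
    exact Submodule.add_mem _ hfh (hh ▸ hhker)
  | zero => exact fun f hf => hQ f hf
  | add x x' _ _ hx hx' =>
    intro f hf
    obtain ⟨g, hg⟩ := exists_toFun_one_eq σ' hσ' x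
    have hgker := hx g hg
    have hfg : f - g ∈ _ := hx' (f - g) (by rw [map_sub, hf, hev, hg, add_sub_cancel_left])
    have : f = (f - g) + g := by abel
    rw [this]
    exact Submodule.add_mem _ hfg hgker
  | smul a x _ hx =>
    intro f hf
    obtain ⟨g, hg⟩ := exists_toFun_one_eq σ' hσ' x
    have hgker := Submodule.smul_mem _ a (hx g hg)
    have hfg : f - a • g ∈ _ := hQ (f - a • g) (by rw [map_sub, map_smul, hf, hev, hg, sub_self])
    have : f = (f - a • g) + a • g := by abel
    rw [this]
    exact Submodule.add_mem _ hfg hgker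

/-- **JM-A part 3, HEAD: THE BOREL JACQUET MODULE OF `Ind_{P₍₂,₁₎}^{GL₃} σ'` VANISHES** (`σ'` smooth, `W = W(X₁₀) = W(X₀₁)`): the `U₃`-coinvariants
`(restrictUnipotentGL F id I).Coinvariants` are a subsingleton.  For `σ' = (σ ∘ proj) ⊗ δ^{1∕2}` with `σ ≅ ρ ⊠ χ` irreducible supercuspidal (both letters ★ BLK):
`r_B(ρ × χ) = 0` — a supercuspidally induced representation of `GL₃` off `GL₂ × GL₁` has no Borel exponents. [cite: BernsteinZelevinsky1977, 2.12] [cite: Casselman1995, §6.3] -/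
theorem subsingleton_coinvariants_restrictUnipotentGL_id (hσ' : σ'.IsSmooth)
    (hW : ∀ w : W, w ∈ Submodule.span ℂ {x : W | ∃ (y : F) (v : W),
      x = σ' ⟨transvectionUnit 1 0 (by decide) y, transvectionUnit_one_zero_mem_standardParabolicGL y⟩ v - v})
    (hW₀₁ : ∀ w : W, w ∈ Submodule.span ℂ {x : W | ∃ (a : F) (v : W),
      x = σ' ⟨transvectionUnit 0 1 (by decide) a, transvectionUnit_zero_one_mem_standardParabolicGL a⟩ v - v}) :
    Subsingleton (Representation.restrictUnipotentGL F (id : Fin 3 → Fin 3)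
      (Representation.smoothIndRep (standardParabolicGL F (![0, 0, 1] : Fin 3 → Fin 2)) σ')).Coinvariants := by
  refine ⟨fun x y => ?_⟩
  obtain ⟨f, rfl⟩ := Representation.Coinvariants.mk_surjective _ x
  obtain ⟨g, rfl⟩ := Representation.Coinvariants.mk_surjective _ y
  rw [Representation.Coinvariants.mk_eq_iff, ker_restrictUnipotentGL_id_eq_top σ' hσ' hW hW₀₁]
  trivial

end Borel

end Summit.HodgeConjecture.HodgeConjecture.Cruxes.H413.K2E3GL3CuspidalBlockJacquetBorel

end
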